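import Summits.MatrixMultiplication.MatrixMultiplication.Theorems.SoloInformedTwistedTPPStructure

/-!
# The cyclic model for Lemma L (few multipliers with fixed points, `m = 2`)

This work, §8.4. In the coprime case of Conjecture C3 (Theorem C2 without fixed-point-freeness) the
host splits as `S⁰ ⊕ S¹` with the multiplier group trivial on `S⁰` and fixed-point-free on `S¹`; the
coinvariant components form an untwisted TPP normal form `F⁰(i,j,k) = i + j + k`, and a CU13 Def.-12
realization of `⟨n,n,n⟩` becomes: sign-twisted triangle equations (E) for the `S¹`-components
`a(i,j), b(j,k), c(k,i)` on ALL index triples, plus SEPARATION (Sep) — no sign pattern solves the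
equation on a mixed cell triple of two distinct index triples in the same fibre `i + j + k = i' + j' + k'`.
The purest instance ("cyclic model") has indices in a commutative group `G` (e.g. `ℤ/n`) and `S¹` any
additive commutative group with multipliers `{±1}`; LEMMA L asks for `#sign-classes ≥ |fibre| / C`.

This file sets the model up (`CyclicModel`) and proves the three class-injectivity statements used in
§8.4–8.4c: `a_injective_on_lines` (1D-injectivity: sign classes of `a` are distinct along each line
`i + j = const`), `lazy_row` (if `a` is constant in `j` then ALL `n²` sign classes of `c` are distinct —
the degenerate wild family `𝓕₀` has rank `≥ n²`), and `a_injective_of_c_lazy` (if `c` is constant in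
`k` up to sign then all `n²` sign classes of `a` are distinct). References: this work §8; CohnUmans2013
(arXiv:1207.6528) Def. 12.
-/

namespace Summit.MatrixMultiplication.MatrixMultiplication.Theorems.TwistedTPP

/-- **The cyclic model.** Indices in a commutative group `G`, values in `S`, multipliers `{±1}`:
(E) on every triple some sign pattern solves `a(i,j) ± b(j,k) ± c(k,i) = 0`; (Sep) for two distinct
triples in one fibre `i+j+k = i'+j'+k'` no sign pattern solves the mixed equation
`a(i,j) ± b(j',k) ± c(k',i') = 0`. [this work, §8.4] -/
structure CyclicModel (G S : Type*) [AddCommGroup G] [AddCommGroup S] where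
  /-- `S¹`-components of the orbit representatives of the three class maps -/
  a : G → G → S
  b : G → G → S
  c : G → G → S
  eqn : ∀ i j k : G, a i j + b j k + c k i = 0 ∨ a i j + b j k - c k i = 0 ∨
    a i j - b j k + c k i = 0 ∨ a i j - b j k - c k i = 0
  sep : ∀ i j k i' j' k' : G, i + j + k = i' + j' + k' → (i, j, k) ≠ (i', j', k') →
    a i j + b j' k + c k' i' ≠ 0 ∧ a i j + b j' k - c k' i' ≠ 0 ∧
    a i j - b j' k + c k' i' ≠ 0 ∧ a i j - b j' k - c k' i' ≠ 0

namespace CyclicModel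

variable {G S : Type*} [AddCommGroup G] [AddCommGroup S] (R : CyclicModel G S)

/-- **1D-injectivity.** Two distinct cells of `a` on one line `i + j = i' + j'` have different sign
classes. [this work, §8.4c] -/
theorem a_injective_on_lines {i j i' j' : G} (hline : i + j = i' + j')
    (hpm : pm (R.a i j) (R.a i' j')) : i = i' ∧ j = j' := by
  by_contra hne
  obtain ⟨h1, h2, h3, h4⟩ := R.sep i j 0 i' j' 0 (by rw [hline])
    (by intro h; simp only [Prod.mk.injEq] at h; exact hne ⟨h.1, h.2.1⟩)
  unfold pm at hpm
  rcases R.eqn i' j' 0 with h | h | h | h <;> rcases hpm with e | e <;>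
    first
    | (apply h1; linear_combination (norm := abel1) e + h)
    | (apply h2; linear_combination (norm := abel1) e + h)
    | (apply h3; linear_combination (norm := abel1) e + h)
    | (apply h4; linear_combination (norm := abel1) e + h)
    | (apply h1; linear_combination (norm := abel1) e - h)
    | (apply h2; linear_combination (norm := abel1) e - h)
    | (apply h3; linear_combination (norm := abel1) e - h)
    | (apply h4; linear_combination (norm := abel1) e - h)

/-- **Lazy-row lemma.** If `a` does not depend on `j`, then all sign classes of `c` are distinct
(over ALL cells, not only along lines): the degenerate wild family `𝓕₀` of §8.4b has rank `≥ n²`.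
[this work, §8.4] -/
theorem lazy_row (hlazy : ∀ i j j' : G, R.a i j = R.a i j') {k i k' i' : G}
    (hpm : pm (R.c k i) (R.c k' i')) : k = k' ∧ i = i' := by
  by_contra hne
  -- move the `a`-cell from `(i, 0)` to `(i, j'')` so that `(i, j'', k)` and `(i', 0, k')` share a fibre
  set j'' : G := i' + k' - i - k with hj''
  obtain ⟨h1, h2, h3, h4⟩ := R.sep i j'' k i' 0 k' (by rw [hj'']; abel)
    (by intro h; simp only [Prod.mk.injEq] at h; exact hne ⟨h.2.2, h.1⟩)
  have ha : R.a i j'' = R.a i 0 := hlazy i j'' 0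
  unfold pm at hpm
  rcases R.eqn i 0 k with h | h | h | h <;> rcases hpm with e | e <;>
    first
    | (apply h1; linear_combination (norm := abel1) ha + h - e)
    | (apply h2; linear_combination (norm := abel1) ha + h + e)
    | (apply h3; linear_combination (norm := abel1) ha + h - e)
    | (apply h4; linear_combination (norm := abel1) ha + h + e)
    | (apply h1; linear_combination (norm := abel1) ha + h + e)
    | (apply h2; linear_combination (norm := abel1) ha + h - e)
    | (apply h3; linear_combination (norm := abel1) ha + h + e)
    | (apply h4; linear_combination (norm := abel1) ha + h - e)

/-- **`k`-lazy `c` forces injective `a`-classes.** If `c(k,i)` is constant in `k` up to sign, then all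
sign classes of `a` are distinct over all cells (case (i) of the flat-slice theorem, §8.4c). -/
theorem a_injective_of_c_lazy (hk : ∀ k k' i : G, pm (R.c k i) (R.c k' i)) {i j i' j' : G}
    (hpm : pm (R.a i j) (R.a i' j')) : i = i' ∧ j = j' := by
  by_contra hne
  -- move the `c`-cell from `(0, i')` to `(k'', i')` so that `(i, j, 0)` and `(i', j', k'')` share a fibre
  set k'' : G := i + j - i' - j' with hk''
  obtain ⟨h1, h2, h3, h4⟩ := R.sep i j 0 i' j' k'' (by rw [hk'']; abel)
    (by intro h; simp only [Prod.mk.injEq] at h; exact hne ⟨h.1, h.2.1⟩)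
  have hc := hk 0 k'' i'
  unfold pm at hpm hc
  rcases R.eqn i' j' 0 with h | h | h | h <;> rcases hpm with e | e <;> rcases hc with f | f <;>
    first
    | (apply h1; linear_combination (norm := abel1) e + h - f)
    | (apply h2; linear_combination (norm := abel1) e + h + f)
    | (apply h3; linear_combination (norm := abel1) e + h - f)
    | (apply h4; linear_combination (norm := abel1) e + h + f)
    | (apply h1; linear_combination (norm := abel1) e + h + f)
    | (apply h2; linear_combination (norm := abel1) e + h - f)
    | (apply h3; linear_combination (norm := abel1) e + h + f)
    | (apply h4; linear_combination (norm := abel1) e + h - f)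
    | (apply h1; linear_combination (norm := abel1) e - h - f)
    | (apply h2; linear_combination (norm := abel1) e - h + f)
    | (apply h3; linear_combination (norm := abel1) e - h - f)
    | (apply h4; linear_combination (norm := abel1) e - h + f)
    | (apply h1; linear_combination (norm := abel1) e - h + f)
    | (apply h2; linear_combination (norm := abel1) e - h - f)
    | (apply h3; linear_combination (norm := abel1) e - h + f)
    | (apply h4; linear_combination (norm := abel1) e - h - f)

/-- **Pointwise clique engine** (Thm 8.7 (iii) and Lemma B (B4), §8.4c–d). If the two `c`-cells
`(k', i)` and `(k', i'')` with `i'' = i + (j'+k) − (j+k')` have the same sign class, then the `b`-cells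
`(j,k) ≠ (j',k')` have different classes: a coincidence would turn `E(i,j',k')` into a vanishing mixed
sum for the same-fibre pair `((i,j',k),(i'',j,k'))`. Only ONE column `k'` of `c` is involved. -/
theorem b_injective_of_c_agree {j k j' k' : G} (i : G)
    (hc : pm (R.c k' i) (R.c k' (i + (j' + k) - (j + k')))) (hpm : pm (R.b j k) (R.b j' k')) :
    j = j' ∧ k = k' := by
  by_contra hne
  set i'' : G := i + (j' + k) - (j + k') with hdef
  obtain ⟨h1, h2, h3, h4⟩ := R.sep i j' k i'' j k' (by rw [hdef]; abel)
    (by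
      intro h
      simp only [Prod.mk.injEq] at h
      exact hne ⟨h.2.1.symm, (h.2.2).symm ▸ rfl⟩)
  unfold pm at hpm hc
  rcases R.eqn i j' k' with h | h | h | h <;> rcases hpm with e | e <;> rcases hc with f | f <;>
    first
    | (apply h1; linear_combination (norm := abel1) h - e - f)
    | (apply h2; linear_combination (norm := abel1) h - e + f)
    | (apply h3; linear_combination (norm := abel1) h + e - f)
    | (apply h4; linear_combination (norm := abel1) h + e + f)
    | (apply h1; linear_combination (norm := abel1) h + e - f)
    | (apply h2; linear_combination (norm := abel1) h + e + f)
    | (apply h3; linear_combination (norm := abel1) h - e - f)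
    | (apply h4; linear_combination (norm := abel1) h - e + f)
    | (apply h1; linear_combination (norm := abel1) h - e + f)
    | (apply h2; linear_combination (norm := abel1) h - e - f)
    | (apply h3; linear_combination (norm := abel1) h + e + f)
    | (apply h4; linear_combination (norm := abel1) h + e - f)
    | (apply h1; linear_combination (norm := abel1) h + e + f)
    | (apply h2; linear_combination (norm := abel1) h + e - f)
    | (apply h3; linear_combination (norm := abel1) h - e + f)
    | (apply h4; linear_combination (norm := abel1) h - e - f)

/-- **Partially `i`-lazy `c` separates `b`-classes** (case (iii) of the flat-slice theorem, §8.4c). If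
`c(k, ·)` is constant up to sign on a set `I₀` of rows (for every `k`), then two distinct cells
`(j,k) ≠ (j',k')` of `b` whose "anti-line difference" `(j'+k) - (j+k')` is realised inside `I₀`
(some `i ∈ I₀` has `i + (j'+k) - (j+k') ∈ I₀`) have different sign classes. With `I₀` a level set of
size `μ` this yields `μ·n` pairwise distinct classes. -/
theorem b_injective_of_c_const_on (I₀ : Set G)
    (hI : ∀ i ∈ I₀, ∀ i'' ∈ I₀, ∀ k : G, pm (R.c k i) (R.c k i'')) {j k j' k' : G}
    (hd : ∃ i ∈ I₀, i + (j' + k) - (j + k') ∈ I₀) (hpm : pm (R.b j k) (R.b j' k')) :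
    j = j' ∧ k = k' := by
  obtain ⟨i, hi, hi''⟩ := hd
  exact R.b_injective_of_c_agree i (hI i hi _ hi'' k') hpm

/-- **Flat endgame** (case (ii) of the flat-slice theorem, §8.4c). If `c = ±(f + l)` everywhere,
`b(j,k) = ±(l_k - g_j)` everywhere and `a(i,j) = ±(f_i + g_j)` at the cell `(i,j)`, then the additive
chart `F(i,j,k) = f_i + g_j + l_k` separates `(i,j,k)` from every other triple of its fibre. Hence `F`
is injective on the part of each fibre whose `a`-cells are in translate form, and `|S| ≥` that size. -/
theorem triple_eq_of_chart_eq (f g l : G → S)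
    (hb : ∀ j k : G, pm (R.b j k) (l k - g j)) (hc : ∀ k i : G, pm (R.c k i) (f i + l k))
    {i j k i' j' k' : G} (ha : pm (R.a i j) (f i + g j)) (hfib : i + j + k = i' + j' + k')
    (hF : f i + g j + l k = f i' + g j' + l k') : i = i' ∧ j = j' ∧ k = k' := by
  by_contra hne
  obtain ⟨h1, h2, h3, h4⟩ := R.sep i j k i' j' k' hfib
    (by intro h; simp only [Prod.mk.injEq] at h; exact hne h)
  have ea := ha
  have eb := hb j' k
  have ec := hc k' i'
  unfold pm at ea eb ec
  rcases ea with ea | ea <;> rcases eb with eb | eb <;> rcases ec with ec | ec <;>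
    first
    | (apply h1; linear_combination (norm := abel1) ea + eb + ec + hF)
    | (apply h1; linear_combination (norm := abel1) ea + eb + ec - hF)
    | (apply h1; linear_combination (norm := abel1) ea + eb - ec + hF)
    | (apply h1; linear_combination (norm := abel1) ea + eb - ec - hF)
    | (apply h1; linear_combination (norm := abel1) ea - eb + ec + hF)
    | (apply h1; linear_combination (norm := abel1) ea - eb + ec - hF)
    | (apply h1; linear_combination (norm := abel1) ea - eb - ec + hF)
    | (apply h1; linear_combination (norm := abel1) ea - eb - ec - hF)
    | (apply h1; linear_combination (norm := abel1) -ea + eb + ec + hF)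
    | (apply h1; linear_combination (norm := abel1) -ea + eb + ec - hF)
    | (apply h1; linear_combination (norm := abel1) -ea + eb - ec + hF)
    | (apply h1; linear_combination (norm := abel1) -ea + eb - ec - hF)
    | (apply h1; linear_combination (norm := abel1) -ea - eb + ec + hF)
    | (apply h1; linear_combination (norm := abel1) -ea - eb + ec - hF)
    | (apply h1; linear_combination (norm := abel1) -ea - eb - ec + hF)
    | (apply h1; linear_combination (norm := abel1) -ea - eb - ec - hF)
    | (apply h2; linear_combination (norm := abel1) ea + eb + ec + hF)
    | (apply h2; linear_combination (norm := abel1) ea + eb + ec - hF)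
    | (apply h2; linear_combination (norm := abel1) ea + eb - ec + hF)
    | (apply h2; linear_combination (norm := abel1) ea + eb - ec - hF)
    | (apply h2; linear_combination (norm := abel1) ea - eb + ec + hF)
    | (apply h2; linear_combination (norm := abel1) ea - eb + ec - hF)
    | (apply h2; linear_combination (norm := abel1) ea - eb - ec + hF)
    | (apply h2; linear_combination (norm := abel1) ea - eb - ec - hF)
    | (apply h2; linear_combination (norm := abel1) -ea + eb + ec + hF)
    | (apply h2; linear_combination (norm := abel1) -ea + eb + ec - hF)
    | (apply h2; linear_combination (norm := abel1) -ea + eb - ec + hF)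
    | (apply h2; linear_combination (norm := abel1) -ea + eb - ec - hF)
    | (apply h2; linear_combination (norm := abel1) -ea - eb + ec + hF)
    | (apply h2; linear_combination (norm := abel1) -ea - eb + ec - hF)
    | (apply h2; linear_combination (norm := abel1) -ea - eb - ec + hF)
    | (apply h2; linear_combination (norm := abel1) -ea - eb - ec - hF)
    | (apply h3; linear_combination (norm := abel1) ea + eb + ec + hF)
    | (apply h3; linear_combination (norm := abel1) ea + eb + ec - hF)
    | (apply h3; linear_combination (norm := abel1) ea + eb - ec + hF)
    | (apply h3; linear_combination (norm := abel1) ea + eb - ec - hF)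
    | (apply h3; linear_combination (norm := abel1) ea - eb + ec + hF)
    | (apply h3; linear_combination (norm := abel1) ea - eb + ec - hF)
    | (apply h3; linear_combination (norm := abel1) ea - eb - ec + hF)
    | (apply h3; linear_combination (norm := abel1) ea - eb - ec - hF)
    | (apply h3; linear_combination (norm := abel1) -ea + eb + ec + hF)
    | (apply h3; linear_combination (norm := abel1) -ea + eb + ec - hF)
    | (apply h3; linear_combination (norm := abel1) -ea + eb - ec + hF)
    | (apply h3; linear_combination (norm := abel1) -ea + eb - ec - hF)
    | (apply h3; linear_combination (norm := abel1) -ea - eb + ec + hF)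
    | (apply h3; linear_combination (norm := abel1) -ea - eb + ec - hF)
    | (apply h3; linear_combination (norm := abel1) -ea - eb - ec + hF)
    | (apply h3; linear_combination (norm := abel1) -ea - eb - ec - hF)
    | (apply h4; linear_combination (norm := abel1) ea + eb + ec + hF)
    | (apply h4; linear_combination (norm := abel1) ea + eb + ec - hF)
    | (apply h4; linear_combination (norm := abel1) ea + eb - ec + hF)
    | (apply h4; linear_combination (norm := abel1) ea + eb - ec - hF)
    | (apply h4; linear_combination (norm := abel1) ea - eb + ec + hF)
    | (apply h4; linear_combination (norm := abel1) ea - eb + ec - hF)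
    | (apply h4; linear_combination (norm := abel1) ea - eb - ec + hF)
    | (apply h4; linear_combination (norm := abel1) ea - eb - ec - hF)

/-! ### The degenerate residue: popular classes (LEMMA B of §8.4d)

A class repeated `μ₀` times in a column of `a` forces `≥ μ₀ n / 4 − n` distinct `b`-classes. The
combinatorial assembly is paper-side; the two algebraic engines are below: 1D-injectivity of `c`
(the block inequality `μ₀ λ₀ ≤ 2n` follows by pigeonhole on `c`-lines) and the SIGN RIGIDITY of the
base pattern on a popular level set seen from a generic column. -/

/-- **1D-injectivity for `c`**: along a line `k + i = const` the sign classes of `c` are pairwise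
distinct (mixed sum with the `c`-cell moved along the line). [this work, §8.4] -/
theorem c_injective_on_lines {k i k' i' : G} (hline : k + i = k' + i')
    (hpm : pm (R.c k i) (R.c k' i')) : k = k' ∧ i = i' := by
  by_contra hne
  obtain ⟨h1, h2, h3, h4⟩ := R.sep i i k i' i k' (by rw [add_assoc, add_comm i k, hline]; abel)
    (by intro h; simp only [Prod.mk.injEq] at h; exact hne ⟨h.2.2, h.1⟩)
  unfold pm at hpm
  rcases R.eqn i i k with h | h | h | h <;> rcases hpm with e | e <;>
    first
    | (apply h1; linear_combination (norm := abel1) h - e)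
    | (apply h2; linear_combination (norm := abel1) h + e)
    | (apply h3; linear_combination (norm := abel1) h - e)
    | (apply h4; linear_combination (norm := abel1) h + e)
    | (apply h1; linear_combination (norm := abel1) h + e)
    | (apply h2; linear_combination (norm := abel1) h - e)
    | (apply h3; linear_combination (norm := abel1) h + e)
    | (apply h4; linear_combination (norm := abel1) h - e)

/-- **Sign rigidity on a popular level set** (the engine of Lemma B, §8.4d). Rows `i, i'` carry the
same value `α` in the base column `j₀` and the same value `αj` in another column `j`; if the base
pattern differs at column `k` — `c k i = ±(α + l)` but `c k i' = ±(α − l)` with `l = b j₀ k` — then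
`l = 0`, or `α = 0`, or `αj = ±α`, or `l = ±αj` (doubling injective). So for a generic column `j`
and all but `O(1)` columns `k` the base pattern is constant on the level set. -/
theorem sign_rigidity (h2 : ∀ x y : S, x + x = y + y → x = y) {i i' j k : G} {α αj l : S}
    (ha : R.a i j = αj) (ha' : R.a i' j = αj)
    (hci : pm (R.c k i) (α + l)) (hci' : pm (R.c k i') (α - l)) :
    l = 0 ∨ α = 0 ∨ pm αj α ∨ pm l αj := by
  unfold pm at hci hci' ⊢
  have e := R.eqn i j k
  have e' := R.eqn i' j k
  rw [ha] at e
  rw [ha'] at e'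
  rcases hci with hc | hc <;> rcases hci' with hc' | hc' <;> rw [hc] at e <;> rw [hc'] at e' <;>
    rcases e with e | e | e | e <;> rcases e' with e' | e' | e' | e' <;>
    first
    | (left; apply h2; rw [add_zero]; linear_combination (norm := abel1) e - e')
    | (left; apply h2; rw [add_zero]; linear_combination (norm := abel1) e' - e)
    | (left; apply h2; rw [add_zero]; linear_combination (norm := abel1) e + e')
    | (left; apply h2; rw [add_zero]; linear_combination (norm := abel1) - e - e')
    | (right; left; apply h2; rw [add_zero]; linear_combination (norm := abel1) e - e')
    | (right; left; apply h2; rw [add_zero]; linear_combination (norm := abel1) e' - e)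
    | (right; left; apply h2; rw [add_zero]; linear_combination (norm := abel1) e + e')
    | (right; left; apply h2; rw [add_zero]; linear_combination (norm := abel1) - e - e')
    | (right; right; left; left; apply h2; linear_combination (norm := abel1) e - e')
    | (right; right; left; left; apply h2; linear_combination (norm := abel1) e' - e)
    | (right; right; left; left; apply h2; linear_combination (norm := abel1) e + e')
    | (right; right; left; left; apply h2; linear_combination (norm := abel1) - e - e')
    | (right; right; left; right; apply h2; linear_combination (norm := abel1) e - e')
    | (right; right; left; right; apply h2; linear_combination (norm := abel1) e' - e)
    | (right; right; left; right; apply h2; linear_combination (norm := abel1) e + e')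
    | (right; right; left; right; apply h2; linear_combination (norm := abel1) - e - e')
    | (right; right; right; left; apply h2; linear_combination (norm := abel1) e - e')
    | (right; right; right; left; apply h2; linear_combination (norm := abel1) e' - e)
    | (right; right; right; left; apply h2; linear_combination (norm := abel1) e + e')
    | (right; right; right; left; apply h2; linear_combination (norm := abel1) - e - e')
    | (right; right; right; right; apply h2; linear_combination (norm := abel1) e - e')
    | (right; right; right; right; apply h2; linear_combination (norm := abel1) e' - e)
    | (right; right; right; right; apply h2; linear_combination (norm := abel1) e + e')

/-- **Base pattern** (definition of `κ` in §8.4c–d, typed): every `c`-cell is `±(a i j₀ + κ · b j₀ k)`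
for some sign `κ`, read off from `E(i,j₀,k)`. -/
theorem c_pm_base (i j₀ k : G) :
    pm (R.c k i) (R.a i j₀ + R.b j₀ k) ∨ pm (R.c k i) (R.a i j₀ - R.b j₀ k) := by
  unfold pm
  rcases R.eqn i j₀ k with h | h | h | h
  · exact Or.inl (Or.inr (by linear_combination (norm := abel1) h))
  · exact Or.inl (Or.inl (by linear_combination (norm := abel1) -h))
  · exact Or.inr (Or.inr (by linear_combination (norm := abel1) h))
  · exact Or.inr (Or.inl (by linear_combination (norm := abel1) -h))

/-- **Candidate values** ((B2) of Lemma B, §8.4d): if `c k i = ±x` then `a i j ∈ {±(b j k + x), ±(b j k − x)}`;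
with `x ∈ {α + l_k, α − l_k}` on a level set this is the negation-closed 8-set, i.e. `≤ 4` classes per column. -/
theorem a_pm_candidates {i j k : G} {x : S} (hc : pm (R.c k i) x) :
    pm (R.a i j) (R.b j k + x) ∨ pm (R.a i j) (R.b j k - x) := by
  unfold pm at hc ⊢
  rcases R.eqn i j k with h | h | h | h <;> rcases hc with e | e <;>
    first
    | exact Or.inl (Or.inl (by linear_combination (norm := abel1) h + e))
    | exact Or.inl (Or.inl (by linear_combination (norm := abel1) h - e))
    | exact Or.inl (Or.inr (by linear_combination (norm := abel1) h + e))
    | exact Or.inl (Or.inr (by linear_combination (norm := abel1) h - e))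
    | exact Or.inr (Or.inl (by linear_combination (norm := abel1) h + e))
    | exact Or.inr (Or.inl (by linear_combination (norm := abel1) h - e))
    | exact Or.inr (Or.inr (by linear_combination (norm := abel1) h + e))
    | exact Or.inr (Or.inr (by linear_combination (norm := abel1) h - e))

/-- Two cells that are `±` the same representative have the same sign class. -/
theorem pm_of_pm_of_pm {u w x : S} (hu : pm u x) (hw : pm w x) : pm u w := by
  unfold pm at hu hw ⊢
  rcases hu with hu | hu <;> rcases hw with hw | hw
  · exact Or.inl (hu.trans hw.symm)
  · exact Or.inr (by rw [hu, hw, neg_neg])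
  · exact Or.inr (by rw [hu, hw])
  · exact Or.inl (by rw [hu, hw])

/-- **Block inequality** ((B1) of Lemma B, §8.4d). If on a block `I₀ × K₀` the `c`-cells take only two
sign classes (`±x` or `±y`), then `|I₀|·|K₀| ≤ 2|G|`: each line `k + i = s` meets the block in at most
two cells, by 1D-injectivity of `c`. Applied with `x = α + β`, `y = α − β` on (popular column level) ×
(base-row class level) it gives `μ₀ λ₀ ≤ 2n`. -/
theorem block_card_le [Fintype G] [DecidableEq G] (I₀ K₀ : Finset G) (x y : S)
    (hcls : ∀ i ∈ I₀, ∀ k ∈ K₀, pm (R.c k i) x ∨ pm (R.c k i) y) :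
    I₀.card * K₀.card ≤ 2 * Fintype.card G := by
  classical
  have key : ∀ s ∈ (I₀ ×ˢ K₀).image (fun p : G × G => p.2 + p.1),
      ((I₀ ×ˢ K₀).filter (fun p : G × G => p.2 + p.1 = s)).card ≤ 2 := by
    intro s _
    by_contra h
    have h3 : 2 < ((I₀ ×ˢ K₀).filter (fun p : G × G => p.2 + p.1 = s)).card := by omega
    obtain ⟨p₁, p₂, p₃, h₁, h₂, h₃, h12, h13, h23⟩ := Finset.two_lt_card_iff.mp h3
    simp only [Finset.mem_filter, Finset.mem_product] at h₁ h₂ h₃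
    -- two of the three cells share a representative, hence a class, on one line: contradiction
    have c₁ := hcls p₁.1 h₁.1.1 p₁.2 h₁.1.2
    have c₂ := hcls p₂.1 h₂.1.1 p₂.2 h₂.1.2
    have c₃ := hcls p₃.1 h₃.1.1 p₃.2 h₃.1.2
    have l12 : p₁.2 + p₁.1 = p₂.2 + p₂.1 := by rw [h₁.2, h₂.2]
    have l13 : p₁.2 + p₁.1 = p₃.2 + p₃.1 := by rw [h₁.2, h₃.2]
    have l23 : p₂.2 + p₂.1 = p₃.2 + p₃.1 := by rw [h₂.2, h₃.2]
    rcases c₁ with c₁ | c₁ <;> rcases c₂ with c₂ | c₂ <;> rcases c₃ with c₃ | c₃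
    · exact h12 (Prod.ext (R.c_injective_on_lines l12 (pm_of_pm_of_pm c₁ c₂)).2
        (R.c_injective_on_lines l12 (pm_of_pm_of_pm c₁ c₂)).1)
    · exact h12 (Prod.ext (R.c_injective_on_lines l12 (pm_of_pm_of_pm c₁ c₂)).2
        (R.c_injective_on_lines l12 (pm_of_pm_of_pm c₁ c₂)).1)
    · exact h13 (Prod.ext (R.c_injective_on_lines l13 (pm_of_pm_of_pm c₁ c₃)).2
        (R.c_injective_on_lines l13 (pm_of_pm_of_pm c₁ c₃)).1)
    · exact h23 (Prod.ext (R.c_injective_on_lines l23 (pm_of_pm_of_pm c₂ c₃)).2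
        (R.c_injective_on_lines l23 (pm_of_pm_of_pm c₂ c₃)).1)
    · exact h23 (Prod.ext (R.c_injective_on_lines l23 (pm_of_pm_of_pm c₂ c₃)).2
        (R.c_injective_on_lines l23 (pm_of_pm_of_pm c₂ c₃)).1)
    · exact h13 (Prod.ext (R.c_injective_on_lines l13 (pm_of_pm_of_pm c₁ c₃)).2
        (R.c_injective_on_lines l13 (pm_of_pm_of_pm c₁ c₃)).1)
    · exact h12 (Prod.ext (R.c_injective_on_lines l12 (pm_of_pm_of_pm c₁ c₂)).2
        (R.c_injective_on_lines l12 (pm_of_pm_of_pm c₁ c₂)).1)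
    · exact h12 (Prod.ext (R.c_injective_on_lines l12 (pm_of_pm_of_pm c₁ c₂)).2
        (R.c_injective_on_lines l12 (pm_of_pm_of_pm c₁ c₂)).1)
  calc I₀.card * K₀.card = (I₀ ×ˢ K₀).card := (Finset.card_product I₀ K₀).symm
    _ ≤ 2 * ((I₀ ×ˢ K₀).image (fun p : G × G => p.2 + p.1)).card :=
        Finset.card_le_mul_card_image _ 2 key
    _ ≤ 2 * Fintype.card G := by
        gcongr
        exact Finset.card_le_univ _

end CyclicModel

end Summit.MatrixMultiplication.MatrixMultiplication.Theorems.TwistedTPP
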